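import Summits.CriticalPhenomena.CardyFormulaZ2.Theorems.CardyBondTriangularBondTriangularCardyKiteBLabel
import Summits.CriticalPhenomena.CardyFormulaZ2.Theorems.CardyBondTriangularBondTriangularCardyBlueArmPrep
import HarnessLib

/-!
# Route CardyBondTriangular · crux `BondTriangularCardy` · line `birth`: the blue arm of Claim 10 — the first interface dart at `w`

Helper of the stub `stub_blueArm`. In the frame of `A₀` (the separating yellow path `Q` through
the bond `x₁x₂` of `w`, traversed with `w` on its left, no yellow path with the same ends
separating `w`), **the kite interface passes by `w`**: there is an admissible interface dart `s₀`
of the kite tiling (`…KiteBDarts`) whose left (blue) kite belongs to a hexagon of `w` and sits at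
the corner `w`, whose right (yellow) kite is a kite of `x₂`, and whose interface predecessor `p₀`
has a kite of `x₁` on its right (`exists_start`) — by cases on the colours of the three kites at
`w` (Bollobás–Riordan's edge `f` of `I` out of `w` when `x₃` is blue at `w`; when `x₁` or `x₂` is
blue at the up-corner `w` the interface runs along the split line of `x₁`/`x₂` through the
midpoint of the edge `wz`; all three yellow at `w` is excluded by `false_of_yellow_at_w`).

## References

* B. Bollobás, O. Riordan, *Percolation*, CUP (2006), Ch. 7, Claim 10 p. 178 ("let `f` be the
  oriented edge of `I` …").
-/

namespace Summit.CriticalPhenomena.CardyFormulaZ2.Theorems.BondTriangularCardyLine.KiteB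

open Finset Literature.Probability.Percolation Literature.Probability.LatticeModels
open TriMarkedDomain (fin3_add_one_add_one fin3_add_two_add_one fin3_add_two_add_two fin3_add_one_add_two)

/-- **The two ends of a side of a face are vertices of the face across it** (registered anchor of
this file). -/
theorem mem_oppFace_of_faceVertex : ∀ (w : Literature.Probability.LatticeModels.HexVertex) (r : Fin 3), Literature.Probability.Percolation.faceVertex w (r + 2) ∈ Literature.Probability.LatticeModels.hexFaceVertices (Literature.Probability.Percolation.oppFace w r) ∧ Literature.Probability.Percolation.faceVertex w (r + 1) ∈ Literature.Probability.LatticeModels.hexFaceVertices (Literature.Probability.Percolation.oppFace w r) := by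
  intro w r
  constructor
  · rw [← faceVertex_oppFace_succ w r]; exact faceVertex_mem _ _
  · rw [← faceVertex_oppFace_succ_succ w r]; exact faceVertex_mem _ _

section Start

variable (D : TriMarkedDomain 3) {σ : CLHexConfig} {w : HexVertex} {r : Fin 3} {Q : List (Site 2)} {nu nv : ℕ}

/-- **The first interface dart at `w` and its predecessor.** With `x₁ = faceVertex w (r+1)`,
`x₂ = faceVertex w (r+2)`, `x₃ = faceVertex w r`: an admissible interface dart `s₀` with left
cell a hexagon of `w` (in `G`), left kite at the corner `w`, right cell `x₂`, and an admissible
interface dart `p₀` with left cell in `G`, `succ p₀ = s₀`, right cell `x₁`. -/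
theorem exists_start (hQne : Q ≠ []) (hQnd : Q.Nodup) (hQch : List.IsChain triGraph.Adj Q)
    (hQG : ∀ s ∈ Q, s ∈ D.verts) (hQB : ∀ s ∈ Q, σ s ≠ CLHexState.B)
    (hQY : ∀ d ∈ pathDarts Q, (clYellowGraph σ).Adj d.1 d.2)
    (hnu1 : D.pos 1 ≤ nu) (hnu2 : nu < D.pos 2) (hnv2 : D.pos 2 ≤ nv) (hnvL : nv < #(triBdryDarts D.verts))
    (hC : IsTriLoop (D.chordLoop Q nv (nu + #(triBdryDarts D.verts) - nv)))
    (hπw : faceLabel (cycDarts (D.chordLoop Q nv (nu + #(triBdryDarts D.verts) - nv))) w =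
      leftLabel (D.chordLoop Q nv (nu + #(triBdryDarts D.verts) - nv)))
    (hnotw : ∀ Q' : List (Site 2), (hne : Q' ≠ []) → Q'.Nodup → List.IsChain triGraph.Adj Q' →
      (∀ s ∈ Q', s ∈ D.verts ∧ σ s ≠ CLHexState.B) → (∀ d ∈ pathDarts Q', (clYellowGraph σ).Adj d.1 d.2) →
      Q'.head hne = Q.head hQne → Q'.getLast hne = Q.getLast hQne →
      ¬ Separates D.verts {e : Sym2 (Site 2) | ∃ d ∈ pathDarts Q', e = s(d.1, d.2)} w (D.stretch 0))
    (hw : hexFaceVertices w ⊆ D.verts)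
    (hdart : (faceVertex w (r + 1), faceVertex w (r + 2)) ∈ pathDarts Q) :
    ∃ s₀ p₀ : KDart, iface (kcol D σ) s₀ = true ∧ s₀.adm = true ∧ s₀.leftCell ∈ D.verts ∧ s₀.leftCorner = w ∧
      s₀.rightCell = faceVertex w (r + 2) ∧ iface (kcol D σ) p₀ = true ∧ p₀.adm = true ∧ p₀.leftCell ∈ D.verts ∧
      succ (kcol D σ) p₀ = s₀ ∧ p₀.rightCell = faceVertex w (r + 1) ∧
      (s₀.leftCell = faceVertex w r ∨ s₀.leftCell = faceVertex w (r + 1) ∨ s₀.leftCell = faceVertex w (r + 2)) := by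
  have hxG : faceVertex w r ∈ D.verts := hw (faceVertex_mem _ _)
  have haG : faceVertex w (r + 1) ∈ D.verts := hw (faceVertex_mem _ _)
  have hbG : faceVertex w (r + 2) ∈ D.verts := hw (faceVertex_mem _ _)
  have haby := hQY _ hdart
  simp only at haby
  have hadj_ab : triGraph.Adj (faceVertex w (r + 1)) (faceVertex w (r + 2)) := (clYellowGraph_le σ) haby
  have hwab : leftFace (faceVertex w (r + 1)) (faceVertex w (r + 2)) = w := leftFace_succ_succ w r
  have hz : leftFace (faceVertex w (r + 2)) (faceVertex w (r + 1)) = oppFace w r := leftFace_faceVertex_rev w r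
  have hwz : w ≠ oppFace w r := (hexGraph_adj_oppFace w r).ne
  obtain ⟨hbz, haz⟩ := mem_oppFace_of_faceVertex w r
  -- the yellow common corner of `x₁, x₂` is `w` or `z`
  obtain ⟨-, G, haG', hbG', hya, hyb⟩ := (clYellowGraph_adj_iff σ _ _).1 haby
  have hGwz : G = w ∨ G = oppFace w r :=
    eq_or_eq_of_common hadj_ab hwz (faceVertex_mem _ _) (faceVertex_mem _ _) haz hbz haG' hbG'
  -- kite colours of hexagons of `G`, as `ccol`
  have cw : ∀ {s : Site 2} {F : HexVertex} (hs : s ∈ D.verts) (hm : s ∈ hexFaceVertices F),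
      ccol D σ s F = decide ((σ s).yellowAt s F) := fun hs hm => ccol_of_mem hs hm
  have e11 := fin3_add_one_add_one r
  have e12 := fin3_add_one_add_two r
  have e21 := fin3_add_two_add_one r
  have e22 := fin3_add_two_add_two r
  have hbx : triGraph.Adj (faceVertex w (r + 2)) (faceVertex w r) := by
    have := TriMarkedDomain.adj_faceVertex_succ w (r + 2); rwa [e21] at this
  by_cases caa : (σ (faceVertex w (r + 1))).yellowAt (faceVertex w (r + 1)) w
  · by_cases cb : (σ (faceVertex w (r + 2))).yellowAt (faceVertex w (r + 2)) w
    · by_cases cx : (σ (faceVertex w r)).yellowAt (faceVertex w r) w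
      · -- all three yellow at `w`: excluded
        exfalso
        have hxB : σ (faceVertex w r) ≠ CLHexState.B := fun h => by rw [h] at cx; exact cx
        refine false_of_yellow_at_w D hQne hQnd hQch hQG hQB hQY hnu1 hnu2 hnv2 hnvL hC hπw hnotw hw hdart hxB ?_ ?_
        · exact (clYellowGraph_adj_iff σ _ _).2 ⟨TriMarkedDomain.adj_faceVertex_succ w r, w, faceVertex_mem _ _,
            faceVertex_mem _ _, cx, caa⟩
        · exact (clYellowGraph_adj_iff σ _ _).2 ⟨hbx.symm, w, faceVertex_mem _ _, faceVertex_mem _ _, cx, cb⟩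
      · -- `x₃` blue at `w`: Bollobás–Riordan's edge `f`
        refine ⟨.toMid w (r + 1), .fromMid w (r + 2), ?_, rfl, ?_, rfl, ?_, ?_, rfl, ?_, ?_, ?_, Or.inl ?_⟩
        · rw [iface_iff']
          simp only [KDart.leftCell, KDart.rightCell, KDart.leftCorner, KDart.rightCorner, e11, e12]
          rw [cw hxG (faceVertex_mem _ _), cw hbG (faceVertex_mem _ _)]
          simp [cx, cb]
        · simp only [KDart.leftCell, e12]; exact hxG
        · simp only [KDart.rightCell, e11]
        · rw [iface_iff']
          simp only [KDart.leftCell, KDart.rightCell, KDart.leftCorner, KDart.rightCorner, e21, e22]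
          rw [cw hxG (faceVertex_mem _ _), cw haG (faceVertex_mem _ _)]
          simp [cx, caa]
        · simp only [KDart.leftCell, e21]; exact hxG
        · have : kcol D σ w (r + 2) = true := by rw [← ccol_faceVertex, cw hbG (faceVertex_mem _ _)]; simp [cb]
          simp only [succ, this, if_true, e22]
        · simp only [KDart.rightCell, e22]
        · simp only [KDart.leftCell, e12]
    · -- `x₂` blue at the up-corner `w`: the interface enters `x₂` at the midpoint of `wz`
      have hGz : G = oppFace w r := by
        rcases hGwz with rfl | h
        · exact absurd hyb cb
        · exact h
      subst hGz
      refine ⟨.toCtr (faceVertex w (r + 2)) (faceVertex w (r + 1)), .toMid w r, ?_, (KDart.adm_toCtr _ _).2 hadj_ab.symm,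
        hbG, hwab, rfl, ?_, rfl, hbG, ?_, rfl, Or.inr (Or.inr rfl)⟩
      · rw [iface_iff']
        simp only [KDart.leftCell, KDart.rightCell, KDart.leftCorner, KDart.rightCorner, hwab, hz]
        rw [cw hbG (faceVertex_mem _ _), cw hbG hbz]
        simp [cb, hyb]
      · rw [iface_iff']
        simp only [KDart.leftCell, KDart.rightCell, KDart.leftCorner, KDart.rightCorner]
        rw [cw hbG (faceVertex_mem _ _), cw haG (faceVertex_mem _ _)]
        simp [cb, caa]
      · have : kcol D σ (oppFace w r) (oppIdx w r + 1) = true := by rw [kcol_oppIdx_succ, cw hbG hbz]; simp [hyb]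
        simp only [succ, this, if_true]
  · -- `x₁` blue at the up-corner `w`: the interface arrives through `x₁`
    have hGz : G = oppFace w r := by
      rcases hGwz with rfl | h
      · exact absurd hya caa
      · exact h
    subst hGz
    have hp₀ : iface (kcol D σ) (.fromCtr (faceVertex w (r + 1)) (faceVertex w (r + 2))) = true := by
      rw [iface_iff']
      simp only [KDart.leftCell, KDart.rightCell, KDart.leftCorner, KDart.rightCorner, hwab, hz]
      rw [cw haG (faceVertex_mem _ _), cw haG haz]
      simp [caa, hya]
    have hkidx : kidx w (faceVertex w (r + 1)) = r + 1 := kidx_faceVertex w (r + 1)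
    by_cases cb : (σ (faceVertex w (r + 2))).yellowAt (faceVertex w (r + 2)) w
    · refine ⟨.fromMid w r, .fromCtr (faceVertex w (r + 1)) (faceVertex w (r + 2)), ?_, rfl, haG, rfl, rfl, hp₀,
        (KDart.adm_fromCtr _ _).2 hadj_ab, haG, ?_, rfl, Or.inr (Or.inl rfl)⟩
      · rw [iface_iff']
        simp only [KDart.leftCell, KDart.rightCell, KDart.leftCorner, KDart.rightCorner]
        rw [cw haG (faceVertex_mem _ _), cw hbG (faceVertex_mem _ _)]
        simp [caa, cb]
      · have : kc (kcol D σ) (faceVertex w (r + 2)) w = true := by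
          rw [kc_kcol, cw hbG (faceVertex_mem _ _)]; simp [cb]
        simp only [succ, hwab, this, hkidx, e12]
        simp
    · refine ⟨.toCtr (faceVertex w (r + 2)) (faceVertex w (r + 1)), .fromCtr (faceVertex w (r + 1)) (faceVertex w (r + 2)), ?_,
        (KDart.adm_toCtr _ _).2 hadj_ab.symm, hbG, hwab, rfl, hp₀, (KDart.adm_fromCtr _ _).2 hadj_ab, haG, ?_, rfl,
        Or.inr (Or.inr rfl)⟩
      · rw [iface_iff']
        simp only [KDart.leftCell, KDart.rightCell, KDart.leftCorner, KDart.rightCorner, hwab, hz]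
        rw [cw hbG (faceVertex_mem _ _), cw hbG hbz]
        simp [cb, hyb]
      · have h1 : kc (kcol D σ) (faceVertex w (r + 2)) (leftFace (faceVertex w (r + 1)) (faceVertex w (r + 2))) = false := by
          rw [kc_kcol, hwab, cw hbG (faceVertex_mem _ _)]; simp [cb]
        have h2 : kc (kcol D σ) (faceVertex w (r + 2)) (leftFace (faceVertex w (r + 2)) (faceVertex w (r + 1))) = true := by
          rw [kc_kcol, hz, cw hbG hbz]; simp [hyb]
        simp only [succ, h1, h2, if_true]
        simp

end Start

end Summit.CriticalPhenomena.CardyFormulaZ2.Theorems.BondTriangularCardyLine.KiteB
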